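import Summits.ValiantsHypothesis.ValiantsHypothesis.Theorems.FifoMatchingNNDivisionHardShadowConstReadPattern

/-!
(PART 3 of 7 of the port — part 3 — §5 antipodal twin rows (`twinRow`, `hCOR_negUd`, ★★★ `twin_block`, `T_lt_of_block_wide`, ★★★★ `twinBlind_decided`) + §5b interaction matrices (`twinRow_dot_interMat`, ★★★★ `interSpan_decided`: 38 g2's `Q_II` decided); split for the 400-line cap; texts verbatim by name, docstrings added to helpers.)
# SHADOW-CONSTANT READ / TWIN ROWS — decided classes of the located law of record C′ = `ExactPencilLaw`

Theorems-side port (staged by the author val-idea-41 g3; press as `Theorems/FifoMatchingNNDivisionHardShadowConstReadTwin.lean`,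
`--kind proof --supports stmt-ValiantsHypothesis-21181 --as helper`) of the crux workfile `Cruxes/NNDivisionHard/ShadowConstRead41.lean`
REV 10 @72ea85f2ab68 (sha16 a021d0dfd0d83740, 1482 l., farm rc 0 / 0 sorries / 0 warnings; critic of record val-idea-crit-9 g2: WAVE-6
KEEP/KILL LIST 2026-08-29T00:50:44Z «41 g3 … `ShadowConstRead41` r1→r6 (★★★ `exactTilted_law_on_offDiagConst`, ★★★
`exactTilted_body_of_partialCommonMax`, `offDiagConst_decided`, ★★★★ `twinBlind_decided` / `interSpan_decided` / `blocks_decided` /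
`twinPCM_decided`)» KEPT; revs 7–10 (§5c–§5f) filed after the list's 00:30Z cut, graded in the wave-7 ledger).  Namespace
`Summit.ValiantsHypothesis.ValiantsHypothesis.Theorems.FifoMatching.ShadowConstRead` (parallel to `…LocatedRows`, whose frame — `T`, `RowFamily`, `three_pow_le_of_block`,
`hCOR`, `exactTilted`, `ExactPencilLaw`, `concl_of_lawBody`, `T_lt_of_block'`, `two_pow_half_mul_le` — is used BY NAME).

CONTENT: typed DECIDED CLASSES of the located law C′ (`exactTilted.Law`) in the tree's flat socket
`HasEFOfSize (corPolytope n + convexHull ℝ (Set.range q)) r → T c n < r`: shadow-constant / diagonal passengers (anchored star–clique tilt),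
partial-common-maximiser lists (junk-tolerant Kaibel–Weltge count), twin-blind / twin-PCM lists (antipodal twin rows; every span of 38 g2's
interaction matrices, so `Q_II`), and the twin transfer: a unique top — or a PCM on the top fibre — of ONE entrywise-nonnegative `S × S` pin.

HONEST LABEL: support theorems about the located LAW C′ on CLASSES of passengers, for an OPEN crux; `ExactPencilLaw` (C′), COR-VIRTUAL,
21181 `NNDivisionHard` are OPEN.  VP ≠ VNP is NOT proved here or anywhere in this tree.
-/

set_option autoImplicit false

-- the mandated summit-side namespace repeats a component by design (single-problem summit)
set_option linter.dupNamespace false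

noncomputable section

namespace Summit.ValiantsHypothesis.ValiantsHypothesis.Theorems.FifoMatching.ShadowConstRead

open Matrix Finset
open Literature.Barriers.PneNP (HasEFOfSize three_pow_le_card_mul_two_pow_of_cover_univ)
open Literature.Combinatorics.Optimization.FixedSizePsdRank (Cube bvec flat vecOuter corPolytope flat_dotProduct_vecOuter
  flat_dotProduct_le_of_mem_corPolytope)
open Summit.ValiantsHypothesis.ValiantsHypothesis.Theorems.FifoMatching.XcDivision
  (udInd udPt udRow udMat udInd_apply udInd_sq udInd_inter ud_data udRow_dotProduct_flat_diagonal flat_dotProduct_flat)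
open Summit.ValiantsHypothesis.ValiantsHypothesis.Theorems.FifoMatching.GridCorShadow (four_T_lt_two_pow)
open Summit.ValiantsHypothesis.ValiantsHypothesis.Theorems.FifoMatching.LocatedRows
  (T RowFamily three_pow_le_of_block two_pow_half_mul_le T_lt_of_block' hCOR le_hCOR exists_eq_hCOR flat_le_hCOR exactTilted ExactPencilLaw
    concl_of_lawBody CorVirtualHardN corVirtualHardN_of_exactPencilLaw sum_mul_udInd flat_dotProduct_udPt_eq flat_sub' flat_add')
open scoped Pointwise

section Part3
variable {k n : ℕ}

/-! §1 THE FRAME is the tree's, BY NAME: `T`, `RowFamily`, `three_pow_le_of_block`, `hCOR`, `le_hCOR`, `exists_eq_hCOR`, `flat_le_hCOR`,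
`exactTilted`, `ExactPencilLaw`, `concl_of_lawBody` (`…RowFamilies` / `…LocatedRowsColumnCoupled`), `two_pow_half_mul_le` (`…PairPencil`),
`T_lt_of_block'` (`…PinExposed`), `sum_mul_udInd` / `flat_dotProduct_udPt_eq` (`…LocatedRowsCeiling`). -/
/-! ## §5 ★★★★ ANTIPODAL TWIN ROWS: the «twin-blind» class — containing 38 g2's wave-7 seed `Q_II` — is DECIDED by C′

Two disjoint embeddings `ι₁ ι₂ : Fin k ↪ Fin n` (twins; `n ≤ 2k + 1`).  The exact-tilted row with clique part `ι₁ a` and tilt `−udMat (ι₂ a)`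
has direction `twinRow a = udRow (ι₁ a) − udRow (ι₂ a)` and right-hand side `1 + hCOR(−udMat (ι₂ a)) = (|a| − 1)²` (`|a| ≥ 2`).  On the
coordinate face `{ι₁ b ∪ ι₂ univ}` its COR-slack is `(|a| − 1)² − [1 − (1 − |a∩b|)²] − [(1 − |a|)² − 1] = (1 − |a∩b|)²`: a PURE UDISJ block of
size `k − 2` (rows `a ⊇ {z₁, z₂}` keep `|a| ≥ 2`).  A passenger on which every twin row is CONSTANT (`TwinBlind`) contributes NOTHING to the
located slack (passenger part `≡ 0`), so `3^{k−2} ≤ (r+1)·2^{k−2}` (`twin_block`) and `T c n < r` eventually (`twinBlind_decided`, flat socket,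
BY NAME via `concl_of_lawBody exactTilted`).  Every interaction matrix `I_{u,v} = Eˢ_{ι₁u ι₁v} − Eˢ_{ι₁u ι₂v} − Eˢ_{ι₂u ι₁v} + Eˢ_{ι₂u ι₂v}`
(38 g2 `ExactPencil38` §10) is ORTHOGONAL to every twin row (the two diagonal blocks cancel, block-diagonal rows do not see the off-diagonal
blocks: `twinRow_dot_interMat`), hence every passenger list whose point differences lie in `span{I_{u,v}}` — 38 g2's `Q_II` = the cube of
interaction differences over 6-tuples with ANY base point, seed S1 of wave 7 — is twin-blind and DECIDED (`interSpan_decided`):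
`xc(COR(n) + Q_II) ≥ 1.5^{k−2} − 1`.  This sits OUTSIDE 40 g5 §5d `no_pure_block_of_private` (that no-go needs the generator supported inside
the row board `U × U`; here every `I_{u,v}` straddles `U = ι₁ univ` and the FIXED column part `S = ι₂ univ`) and outside 38 g2 §10 (the
transversal face `F_π`; here the face is `{b ⊇ ι₂ univ}`).  ENEMY SPEC (E19): an enemy of C′ must move some twin row `udRow(ι₁a) − udRow(ι₂a)`
for EVERY twin pair `(ι₁, ι₂)` covering all but `O(1)` points — equivalently its direction space must NOT have equal symmetrised diagonal
twin blocks. -/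


/-- `flat (−M) = −flat M`. -/
theorem flat_neg₄₁ (M : Matrix (Fin n) (Fin n) ℝ) : flat (-M) = -flat M := by
  funext p; rfl

/-- the images of `ι₁` and `ι₂` are disjoint. -/
theorem map_inter_map_eq_empty (ι₁ ι₂ : Fin k ↪ Fin n) (hι : ∀ i j, ι₁ i ≠ ι₂ j) (s t : Finset (Fin k)) :
    s.map ι₁ ∩ t.map ι₂ = ∅ := by
  classical
  refine Finset.disjoint_iff_inter_eq_empty.mp (Finset.disjoint_left.mpr ?_)
  intro x hx hx'
  obtain ⟨i, -, rfl⟩ := Finset.mem_map.mp hx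
  obtain ⟨j, -, hj⟩ := Finset.mem_map.mp hx'
  exact hι i j hj.symm

/-- the `ι₁`-part of a twin column meets `ι₁ s` in `ι₁ (s ∩ t)`. -/
theorem map_inter_col (ι₁ ι₂ : Fin k ↪ Fin n) (hι : ∀ i j, ι₁ i ≠ ι₂ j) (s t : Finset (Fin k)) :
    s.map ι₁ ∩ (t.map ι₁ ∪ (Finset.univ : Finset (Fin k)).map ι₂) = (s ∩ t).map ι₁ := by
  classical
  rw [Finset.inter_union_distrib_left, map_inter_map_eq_empty ι₁ ι₂ hι, Finset.union_empty]
  exact (Finset.map_inter _ _).symm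

/-- the fixed part `ι₂ univ` of a twin column contains every `ι₂ s`. -/
theorem map_inter_col' (ι₁ ι₂ : Fin k ↪ Fin n) (hι : ∀ i j, ι₁ i ≠ ι₂ j) (s t : Finset (Fin k)) :
    s.map ι₂ ∩ (t.map ι₁ ∪ (Finset.univ : Finset (Fin k)).map ι₂) = s.map ι₂ := by
  classical
  rw [Finset.inter_union_distrib_left]
  have h1 : s.map ι₂ ∩ t.map ι₁ = ∅ := by rw [Finset.inter_comm]; exact map_inter_map_eq_empty ι₁ ι₂ hι t s
  have h2 : s.map ι₂ ∩ (Finset.univ : Finset (Fin k)).map ι₂ = s.map ι₂ :=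
    Finset.inter_eq_left.mpr (Finset.map_subset_map.mpr (Finset.subset_univ s))
  rw [h1, h2, Finset.empty_union]

/-- the ANTIPODAL TWIN ROW of `a ⊆ Fin k`: `udRow (ι₁ a) − udRow (ι₂ a)`. -/
noncomputable def twinRow (ι₁ ι₂ : Fin k ↪ Fin n) (a : Finset (Fin k)) : Fin (n * n) → ℝ :=
  udRow (a.map ι₁) - udRow (a.map ι₂)

/-- the twin direction reads `(1 − |ι₂a ∩ b|)² − (1 − |ι₁a ∩ b|)²` at the clique vertex `x_b`. -/
theorem twinRow_dot_udPt (ι₁ ι₂ : Fin k ↪ Fin n) (a : Finset (Fin k)) (b : Finset (Fin n)) :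
    twinRow ι₁ ι₂ a ⬝ᵥ udPt b = (1 - ((a.map ι₂ ∩ b).card : ℝ)) ^ 2 - (1 - ((a.map ι₁ ∩ b).card : ℝ)) ^ 2 := by
  classical
  obtain ⟨-, -, slack, -⟩ := ud_data n
  have h1 := slack (a.map ι₁) b
  have h2 := slack (a.map ι₂) b
  unfold twinRow
  rw [sub_dotProduct]
  linarith

/-- `⟨flat (−udMat (ι₂ a)), x_b⟩ = (1 − |ι₂ a ∩ b|)² − 1`. -/
theorem negUd_dot (ι₂ : Fin k ↪ Fin n) (a : Finset (Fin k)) (b : Finset (Fin n)) :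
    flat (-udMat (a.map ι₂)) ⬝ᵥ udPt b = (1 - ((a.map ι₂ ∩ b).card : ℝ)) ^ 2 - 1 := by
  classical
  obtain ⟨-, -, slack, -⟩ := ud_data n
  have h2 := slack (a.map ι₂) b
  rw [flat_neg₄₁, neg_dotProduct]
  change -(udRow (a.map ι₂) ⬝ᵥ udPt b) = _
  linarith

/-- `hCOR(−udMat (ι₂ a)) = (|a| − 1)² − 1` for `|a| ≥ 2` (attained at `b = ι₂ a`). -/
theorem hCOR_negUd (ι₂ : Fin k ↪ Fin n) (a : Finset (Fin k)) (ha : 2 ≤ a.card) :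
    hCOR (-udMat (a.map ι₂)) = ((a.card : ℝ) - 1) ^ 2 - 1 := by
  classical
  apply le_antisymm
  · obtain ⟨b, hb⟩ := exists_eq_hCOR (-udMat (a.map ι₂))
    rw [← hb, negUd_dot]
    have hle : ((a.map ι₂ ∩ b).card : ℝ) ≤ a.card := by
      have := Finset.card_le_card (Finset.inter_subset_left : a.map ι₂ ∩ b ⊆ a.map ι₂)
      rw [Finset.card_map] at this
      exact_mod_cast this
    have h0 : (0 : ℝ) ≤ (a.map ι₂ ∩ b).card := Nat.cast_nonneg _
    have h2 : (2 : ℝ) ≤ a.card := by exact_mod_cast ha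
    nlinarith [mul_nonneg (by linarith : (0 : ℝ) ≤ a.card + (a.map ι₂ ∩ b).card - 2)
      (by linarith : (0 : ℝ) ≤ a.card - (a.map ι₂ ∩ b).card)]
  · have h := le_hCOR (-udMat (a.map ι₂)) (a.map ι₂)
    rw [negUd_dot, Finset.inter_self, Finset.card_map] at h
    have e : ((a.card : ℝ) - 1) ^ 2 = (1 - (a.card : ℝ)) ^ 2 := by ring
    rw [e]
    exact h

/-- «TWIN-BLIND» passenger lists: every antipodal twin row is CONSTANT on the listed points. -/
def TwinBlind (ι₁ ι₂ : Fin k ↪ Fin n) {K : ℕ} (q : Fin (K + 1) → (Fin (n * n) → ℝ)) : Prop :=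
  ∀ (a : Finset (Fin k)) (j j' : Fin (K + 1)), twinRow ι₁ ι₂ a ⬝ᵥ q j = twinRow ι₁ ι₂ a ⬝ᵥ q j'

/-- ★★★ THE TWIN BLOCK (pure UDISJ of size `k − 2`).  For ANY twin-blind passenger list, two labels `z₁ ≠ z₂`, ANY admissible row maxima and
ANY nonnegative factorization of the exact-law located slack of `(COR(n), q)` through `Option (Fin r)`: `3^{k−2} ≤ (r+1)·2^{k−2}` — rows
`(ι₁(a' ∪ {z₁,z₂}), −udMat (ι₂(a' ∪ {z₁,z₂})))`, columns `(ι₁ b' ∪ ι₂ univ, 0)`. -/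
theorem twin_block (ι₁ ι₂ : Fin k ↪ Fin n) (hι : ∀ i j, ι₁ i ≠ ι₂ j) {K r : ℕ} (q : Fin (K + 1) → (Fin (n * n) → ℝ))
    (hq : TwinBlind ι₁ ι₂ q) {z₁ z₂ : Fin k} (hz : z₁ ≠ z₂)
    (mrow : exactTilted.A n → ℝ) (_hm1 : ∀ a j, exactTilted.ρ n a ⬝ᵥ q j ≤ mrow a)
    (hm2 : ∀ a, ∃ j, exactTilted.ρ n a ⬝ᵥ q j = mrow a)
    (U : exactTilted.A n → Option (Fin r) → ℝ) (V : Finset (Fin n) × Fin (K + 1) → Option (Fin r) → ℝ)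
    (hU : ∀ a i, 0 ≤ U a i) (hV : ∀ p i, 0 ≤ V p i)
    (hfac : ∀ a b j, (exactTilted.β n a + mrow a) - exactTilted.ρ n a ⬝ᵥ (udPt b + q j) = ∑ i, U a i * V (b, j) i) :
    3 ^ (k - 2) ≤ (r + 1) * 2 ^ (k - 2) := by
  classical
  set α : Finset (Fin k) := (Finset.univ.erase z₁).erase z₂ with hαdef
  have hz₂ : z₂ ∈ Finset.univ.erase z₁ := Finset.mem_erase.mpr ⟨hz.symm, Finset.mem_univ _⟩
  have hαcard : α.card = k - 2 := by
    rw [hαdef, Finset.card_erase_of_mem hz₂, Finset.card_erase_of_mem (Finset.mem_univ _), Finset.card_univ, Fintype.card_fin]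
    omega
  have hαmem : ∀ x ∈ α, x ≠ z₁ ∧ x ≠ z₂ := fun x hx => by
    simp only [hαdef, Finset.mem_erase] at hx
    exact ⟨hx.2.1, hx.1⟩
  have hz₁e : ∀ s : Finset ↥α, z₁ ∉ embα α s := fun s h => (hαmem _ (mem_of_mem_embα h)).1 rfl
  have hz₂e : ∀ s : Finset ↥α, z₂ ∉ embα α s := fun s h => (hαmem _ (mem_of_mem_embα h)).2 rfl
  -- full row index sets `a' ∪ {z₁, z₂}`
  let full : Finset ↥α → Finset (Fin k) := fun a' => insert z₁ (insert z₂ (embα α a'))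
  have hfull_card : ∀ a', (full a').card = a'.card + 2 := fun a' => by
    have h1 : z₁ ∉ insert z₂ (embα α a') := fun h => by
      rcases Finset.mem_insert.mp h with h | h
      · exact hz h
      · exact hz₁e a' h
    show (insert z₁ (insert z₂ (embα α a'))).card = _
    rw [Finset.card_insert_of_notMem h1, Finset.card_insert_of_notMem (hz₂e a'), card_embα]
  have hfull_inter : ∀ a' b' : Finset ↥α, full a' ∩ embα α b' = embα α (a' ∩ b') := fun a' b' => by
    show insert z₁ (insert z₂ (embα α a')) ∩ embα α b' = _
    rw [Finset.insert_inter_of_notMem (hz₁e b'), Finset.insert_inter_of_notMem (hz₂e b'), embα_inter]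
  -- rows and columns
  let row : Finset ↥α → exactTilted.A n := fun a' => ((full a').map ι₁, -udMat ((full a').map ι₂))
  let colset : Finset ↥α → Finset (Fin n) := fun b' => (embα α b').map ι₁ ∪ (Finset.univ : Finset (Fin k)).map ι₂
  have hρ : ∀ a', exactTilted.ρ n (row a') = twinRow ι₁ ι₂ (full a') := fun a' => by
    show udRow ((full a').map ι₁) + flat (-udMat ((full a').map ι₂)) = udRow ((full a').map ι₁) - flat (udMat ((full a').map ι₂))
    rw [flat_neg₄₁, sub_eq_add_neg]
  have hβ : ∀ a', exactTilted.β n (row a') = 1 + hCOR (-udMat ((full a').map ι₂)) := fun _ => rfl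
  -- twin-blindness: the passenger part of the located slack vanishes
  have hpass : ∀ a' j, exactTilted.ρ n (row a') ⬝ᵥ q j = mrow (row a') := fun a' j => by
    obtain ⟨j', hj'⟩ := hm2 (row a')
    rw [← hj', hρ]
    exact hq (full a') j j'
  -- the block identity
  have key := three_pow_le_of_block U V hU hV row (fun b' => (colset b', (0 : Fin (K + 1)))) (fun a' b' => ?_)
  · have h1 : Fintype.card ↥α = k - 2 := by rw [Fintype.card_coe, hαcard]
    have h2 : Fintype.card (Option (Fin r)) = r + 1 := by simp
    rw [h1, h2] at key
    exact key
  · have hi1 : (full a').map ι₁ ∩ colset b' = (embα α (a' ∩ b')).map ι₁ := by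
      show (full a').map ι₁ ∩ ((embα α b').map ι₁ ∪ (Finset.univ : Finset (Fin k)).map ι₂) = _
      rw [map_inter_col ι₁ ι₂ hι, hfull_inter]
    have hi2 : (full a').map ι₂ ∩ colset b' = (full a').map ι₂ := map_inter_col' ι₁ ι₂ hι _ _
    rw [← hfac (row a') (colset b') 0, dotProduct_add, hpass a' 0, hβ, hCOR_negUd ι₂ _ (by rw [hfull_card]; omega), hρ,
      twinRow_dot_udPt, hi1, hi2, Finset.card_map, Finset.card_map, card_embα, hfull_card]
    push_cast
    ring

/-- rate: a block of size `g` with `n ≤ 2g + 5` beats `T c n` eventually. -/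
theorem T_lt_of_block_wide (c : ℕ) : ∃ n₀ : ℕ, ∀ n ≥ n₀, ∀ g r : ℕ, n ≤ 2 * g + 5 → 3 ^ g ≤ (r + 1) * 2 ^ g → T c n < r := by
  obtain ⟨t₁, ht₁⟩ := four_T_lt_two_pow c (c₀ := 1 / 6) (by norm_num)
  refine ⟨max t₁ 40, fun n hn g r hng hr => ?_⟩
  have hn40 : 40 ≤ n := le_of_max_le_right hn
  have hdiv : n ≤ 6 * (g / 2) := by omega
  have hreal : (1 / 6 : ℝ) * n ≤ ((g / 2 : ℕ) : ℝ) := by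
    have : (n : ℝ) ≤ 6 * ((g / 2 : ℕ) : ℝ) := by exact_mod_cast hdiv
    linarith
  have h4 := ht₁ n (le_of_max_le_left hn) (g / 2) hreal
  have hpow : 2 ^ (g / 2) * 2 ^ g ≤ (r + 1) * 2 ^ g := (two_pow_half_mul_le g).trans hr
  have hle : 2 ^ (g / 2) ≤ r + 1 := Nat.le_of_mul_le_mul_right hpow (Nat.pos_of_ne_zero (by positivity))
  have hT : 1 ≤ T c n := Nat.one_le_two_pow
  unfold T at hT ⊢
  omega

/-- ★★★★ **TWIN-BLIND PASSENGERS ARE DECIDED** (flat socket, eventually in `n`, BY NAME via the tree's `concl_of_lawBody exactTilted`): for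
`n ≥ n₀(c)`, any twins `ι₁ ι₂ : Fin k ↪ Fin n` with disjoint images and `n ≤ 2k + 1`, every twin-blind passenger list `q` satisfies
`HasEFOfSize (COR(n) + conv q) r → T c n < r`. -/
theorem twinBlind_decided (c₀ : ℕ) : ∃ n₀ : ℕ, ∀ n ≥ n₀, ∀ (k : ℕ) (ι₁ ι₂ : Fin k ↪ Fin n), (∀ i j, ι₁ i ≠ ι₂ j) → n ≤ 2 * k + 1 →
    ∀ (K : ℕ) (q : Fin (K + 1) → (Fin (n * n) → ℝ)) (r : ℕ), TwinBlind ι₁ ι₂ q →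
    HasEFOfSize (corPolytope n + convexHull ℝ (Set.range q)) r → T c₀ n < r := by
  classical
  obtain ⟨n₀, hn₀⟩ := T_lt_of_block_wide c₀
  refine ⟨max n₀ 5, fun n hn k ι₁ ι₂ hι hnk K q r hq hR => ?_⟩
  have hn5 : 5 ≤ n := le_of_max_le_right hn
  have hk2 : 2 ≤ k := by omega
  refine concl_of_lawBody exactTilted q (fun m hm1 hm2 U V hU hV hfac => ?_) hR
  have hz : (⟨0, by omega⟩ : Fin k) ≠ ⟨1, by omega⟩ := Fin.ne_of_val_ne (by norm_num)
  have hblock := twin_block ι₁ ι₂ hι q hq hz m hm1 hm2 U V hU hV hfac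
  exact hn₀ n (le_of_max_le_left hn) (k - 2) r (by omega) hblock

/-! ### §5b  38 g2's interaction matrices are invisible to twin rows ⇒ `Q_II` is twin-blind ⇒ DECIDED -/

/-- the symmetric elementary matrix `Eˢ_{xy} = E_{xy} + E_{yx}`. -/
def Es (x y : Fin n) : Matrix (Fin n) (Fin n) ℝ := fun i j =>
  (if i = x ∧ j = y then 1 else 0) + (if i = y ∧ j = x then 1 else 0)

/-- 38 g2's INTERACTION MATRIX `I_{u,v} := Eˢ_{ι₁u ι₁v} − Eˢ_{ι₁u ι₂v} − Eˢ_{ι₂u ι₁v} + Eˢ_{ι₂u ι₂v}` (`ExactPencil38` §10; `Q_II` is the cube of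
differences `I_{u,v} − I_{u,v'}` over 6-tuples with a base point). -/
def interMat (ι₁ ι₂ : Fin k ↪ Fin n) (u v : Fin k) : Matrix (Fin n) (Fin n) ℝ :=
  Es (ι₁ u) (ι₁ v) - Es (ι₁ u) (ι₂ v) - Es (ι₂ u) (ι₁ v) + Es (ι₂ u) (ι₂ v)

/-- `⟨flat M, flat (Es x y)⟩ = M x y + M y x`. -/
theorem flat_dot_Es (M : Matrix (Fin n) (Fin n) ℝ) (x y : Fin n) : flat M ⬝ᵥ flat (Es x y) = M x y + M y x := by
  have h : ∀ x y : Fin n, ∑ i, ∑ j, M i j * (if i = x ∧ j = y then (1 : ℝ) else 0) = M x y := by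
    intro x y
    rw [Fintype.sum_eq_single x (fun i hi => Finset.sum_eq_zero (fun j _ => by rw [if_neg (fun h => hi h.1), mul_zero])),
      Fintype.sum_eq_single y (fun j hj => by rw [if_neg (fun h => hj h.2), mul_zero])]
    simp
  rw [flat_dotProduct_flat]
  simp only [Es, mul_add, Finset.sum_add_distrib]
  rw [h, h]

/-- `[ι i ∈ ι s] = [i ∈ s]`. -/
theorem udInd_map_self (ι : Fin k ↪ Fin n) (a : Finset (Fin k)) (u : Fin k) : udInd (a.map ι) (ι u) = udInd a u := by
  simp only [udInd_apply, Finset.mem_map']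

/-- disjoint twins: `[ι' j ∈ ι s] = 0`. -/
theorem udInd_map_other (ι ι' : Fin k ↪ Fin n) (h : ∀ i j, ι i ≠ ι' j) (a : Finset (Fin k)) (u : Fin k) :
    udInd (a.map ι) (ι' u) = 0 := by
  rw [udInd_apply, if_neg]
  intro hu
  obtain ⟨i, -, hi⟩ := Finset.mem_map.mp hu
  exact h i u hi

/-- the value of a matrix against an interaction matrix, entrywise. -/
theorem flat_dot_interMat (M : Matrix (Fin n) (Fin n) ℝ) (ι₁ ι₂ : Fin k ↪ Fin n) (u v : Fin k) :
    flat M ⬝ᵥ flat (interMat ι₁ ι₂ u v)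
      = (M (ι₁ u) (ι₁ v) + M (ι₁ v) (ι₁ u)) - (M (ι₁ u) (ι₂ v) + M (ι₂ v) (ι₁ u))
        - (M (ι₂ u) (ι₁ v) + M (ι₁ v) (ι₂ u)) + (M (ι₂ u) (ι₂ v) + M (ι₂ v) (ι₂ u)) := by
  unfold interMat
  rw [flat_add', flat_sub', flat_sub', dotProduct_add, dotProduct_sub, dotProduct_sub, flat_dot_Es, flat_dot_Es, flat_dot_Es,
    flat_dot_Es]

/-- ★ every twin row is ORTHOGONAL to every interaction matrix. -/
theorem twinRow_dot_interMat (ι₁ ι₂ : Fin k ↪ Fin n) (hι : ∀ i j, ι₁ i ≠ ι₂ j) (a : Finset (Fin k)) (u v : Fin k) :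
    twinRow ι₁ ι₂ a ⬝ᵥ flat (interMat ι₁ ι₂ u v) = 0 := by
  have hι' : ∀ i j, ι₂ i ≠ ι₁ j := fun i j h => hι j i h.symm
  have htw : twinRow ι₁ ι₂ a = flat (udMat (a.map ι₁) - udMat (a.map ι₂)) := by
    unfold twinRow udRow; rw [flat_sub']
  rw [htw, flat_dot_interMat]
  simp only [Matrix.sub_apply, udMat, udInd_map_self, udInd_map_other ι₁ ι₂ hι, udInd_map_other ι₂ ι₁ hι',
    EmbeddingLike.apply_eq_iff_eq, hι, hι', if_false]
  ring

/-- every passenger list whose point differences lie in `span{I_{u,v}}` is twin-blind (in particular `Q_II` with any base point). -/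
theorem twinBlind_of_interSpan (ι₁ ι₂ : Fin k ↪ Fin n) (hι : ∀ i j, ι₁ i ≠ ι₂ j) {K : ℕ} (q : Fin (K + 1) → (Fin (n * n) → ℝ))
    (hq : ∀ j j', q j - q j' ∈ Submodule.span ℝ (Set.range fun p : Fin k × Fin k => flat (interMat ι₁ ι₂ p.1 p.2))) :
    TwinBlind ι₁ ι₂ q := by
  intro a j j'
  have hker : ∀ x, x ∈ Submodule.span ℝ (Set.range fun p : Fin k × Fin k => flat (interMat ι₁ ι₂ p.1 p.2)) →
      twinRow ι₁ ι₂ a ⬝ᵥ x = 0 := by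
    intro x hx
    induction hx using Submodule.span_induction with
    | mem v hv =>
      obtain ⟨p, rfl⟩ := hv
      exact twinRow_dot_interMat ι₁ ι₂ hι a p.1 p.2
    | zero => simp
    | add x y _ _ hx hy => rw [dotProduct_add, hx, hy, add_zero]
    | smul c x _ hx => rw [dotProduct_smul, hx, smul_zero]
  have h0 := hker _ (hq j j')
  rw [dotProduct_sub] at h0
  linarith

/-- ★★★★ **`Q_II` IS DECIDED**: for `n ≥ n₀(c)` and twins covering all but `≤ 1` point, EVERY passenger list whose point differences lie in
`span{I_{u,v}}` (38 g2's `Q_II`, any base point, any budget) satisfies `HasEFOfSize (COR(n) + conv q) r → T c n < r`. -/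
theorem interSpan_decided (c₀ : ℕ) : ∃ n₀ : ℕ, ∀ n ≥ n₀, ∀ (k : ℕ) (ι₁ ι₂ : Fin k ↪ Fin n), (∀ i j, ι₁ i ≠ ι₂ j) → n ≤ 2 * k + 1 →
    ∀ (K : ℕ) (q : Fin (K + 1) → (Fin (n * n) → ℝ)) (r : ℕ),
    (∀ j j', q j - q j' ∈ Submodule.span ℝ (Set.range fun p : Fin k × Fin k => flat (interMat ι₁ ι₂ p.1 p.2))) →
    HasEFOfSize (corPolytope n + convexHull ℝ (Set.range q)) r → T c₀ n < r := by
  obtain ⟨n₀, hn₀⟩ := twinBlind_decided c₀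
  exact ⟨n₀, fun n hn k ι₁ ι₂ hι hnk K q r hq hR => hn₀ n hn k ι₁ ι₂ hι hnk K q r (twinBlind_of_interSpan ι₁ ι₂ hι q hq) hR⟩

end Part3

end Summit.ValiantsHypothesis.ValiantsHypothesis.Theorems.FifoMatching.ShadowConstRead
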